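import Mathlib
import Summits.ResolutionOfSingularities.ResolutionOfSingularities.Theorems.WildQuotientsKiralyLutkebohmertLemmas
import Literature.RingTheory.Depth.CohenMacaulayFiniteOverRegular
import Literature.RingTheory.Depth.CohenMacaulayGradeHeight
import Literature.AlgebraicGeometry.Resolution.KiralyLutkebohmertCriterionProofs
import HarnessLib

/-!
# Király–Lütkebohmert (ANT 7 (2013)), §3: Conjecture 9 holds for `p = 2`, and Thm. 2 (d) ⇒ (c)

Route `ResolutionOfSingularities/WildQuotients`; helper toward the depth-0 / kill-criterion dictionary
of the crux `CyclicQuotientFourfolds` (stmt-ResolutionOfSingularities-17941, research stub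
`stub_reachLowerInFX`; finding F10 of the line: «typed tightness needs GOOD ⇒ PRINCIPAL», which is
Király–Lütkebohmert's conjecture). F. Király, W. Lütkebohmert, *Group actions of prime order on local
normal rings*, Algebra & Number Theory 7 (2013) 63–74.

**Conjecture 9** (loc. cit. §3): for a regular local ring `B` with a `p`-cyclic group of local
automorphisms, `I_G` principal ⇔ `A := B^G` regular. `(1) ⇒ (2)` is Thm. 2 (tree:
`kl_isRegularLocalRing_eqLocus`); the converse is OPEN in general and proved in print for `p ≤ 3`
(«Since `A` is regular, the ring `B` is a free `A`-module of rank `p`; see [Serre 1965, IV, Prop. 22] …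
In the case `p = 2` …»). This file proves the case `p = 2`:

* `kl_free_of_isRegularLocalRing_fixed` — **Thm. 2 (d) ⇒ (c)** («[Serre 1965, IV, Prop. 22]»): if `B`
  is a regular local ring, module-finite over the fixed subring `A = B^σ`, and `A` is a regular local
  ring, then `B` is a free `A`-module — from the tree's Bruns–Herzog Prop. 2.2.11
  (`Literature.RingTheory.Depth.isCohenMacaulayLocalRing_iff_free_subring`) and Cor. 2.2.6
  (regular ⇒ Cohen–Macaulay).
* `kl_exists_fin_span_eq_top_of_free` — the RANK COUNT «free of rank `p`»: for a domain `B` and `σ`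
  of prime order `p`, a free module-finite `B` over `B^σ` is generated by `p` elements (an
  `A`-basis of `B` stays linearly independent over the fixed field `K = L^σ` of `L = Frac B`, and
  `[L : K] = p` by Artin's theorem).
* `kl_exists_augIdeal_eq_span_singleton_of_span_two` — the `p = 2` step: if `B` (local) is generated
  by two elements over `B^σ` then `B = B^σ + B^σ·β` for one of them and `I_G = (σ β − β)`.
* `kl_conjecture9_two` — **Conjecture 9 for `p = 2`**: `B` regular local, `σ ≠ 1`, `σ² = 1`, `B`
  module-finite over `B^σ` and `B^σ` regular local ⇒ the augmentation ideal `(σ c − c : c ∈ B)` is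
  principal. [cite: KiralyLutkebohmert2013, §3 (Conjecture 9, case p = 2), p. 70]

[OURS · crux stmt-ResolutionOfSingularities-17941 · helper (def-free), printed statements of
KiralyLutkebohmert2013 §3 / Thm. 2; counted 0; AI-level work, weaker than expert review.]
-/

-- single-problem summit: the doubled namespace component `ResolutionOfSingularities` is forced
set_option linter.dupNamespace false

open IsLocalRing

namespace Summit.ResolutionOfSingularities.ResolutionOfSingularities.Theorems

universe u

section Serre

/-- **Király–Lütkebohmert, Thm. 2 (d) ⇒ (c)** («follows from [Serre 1965, IV, Prop. 22]»): a regular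
local ring `B`, module-finite over the fixed subring `B^σ` of a ring automorphism `σ`, is a FREE
`B^σ`-module as soon as `B^σ` is a regular local ring (regular ⇒ Cohen–Macaulay, and a local ring
module-finite over a regular local subring is Cohen–Macaulay iff free, Bruns–Herzog 2.2.11).
[cite: KiralyLutkebohmert2013, Thm. 2 (d)⇒(c), p. 69] [cite: BrunsHerzog1998, Prop. 2.2.11, Cor. 2.2.6] -/
theorem kl_free_of_isRegularLocalRing_fixed {B : Type u} [CommRing B] [IsRegularLocalRing B]
    (σ : B ≃+* B) [IsRegularLocalRing ((σ : B →+* B).eqLocus (RingHom.id B))]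
    [Module.Finite ((σ : B →+* B).eqLocus (RingHom.id B)) B] :
    Module.Free ((σ : B →+* B).eqLocus (RingHom.id B)) B :=
  (Literature.RingTheory.Depth.isCohenMacaulayLocalRing_iff_free_subring
      ((σ : B →+* B).eqLocus (RingHom.id B))).mp
    (Literature.RingTheory.Depth.isCohenMacaulayLocalRing_of_isRegularLocalRing B)

end Serre

section Rank

/-- **«`B` is a free `A`-module of rank `p`»** (Király–Lütkebohmert §3, the count behind (∗)): let
`B` be a domain and `σ` a ring automorphism of prime order `p` (`σ ≠ 1`, `σ^p = 1`). If `B` is free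
and module-finite over the fixed ring `A = B^σ`, then `B` is generated over `A` by `p` elements:
an `A`-basis of `B` is linearly independent over the fixed field `K` of `σ` on `L = Frac B`
(denominators can be taken `σ`-invariant: `b/b' = bσ(b')⋯/N(b')`), and `[L : K] = p` (Artin).
[cite: KiralyLutkebohmert2013, §3 p. 70 and Prop. 5] -/
theorem kl_exists_fin_span_eq_top_of_free {B : Type*} [CommRing B] [IsDomain B] {p : ℕ}
    (hp : p.Prime) (σ : B ≃+* B) (hσ : σ ^ p = 1) (hσ1 : σ ≠ 1)
    [Module.Free ((σ : B →+* B).eqLocus (RingHom.id B)) B]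
    [Module.Finite ((σ : B →+* B).eqLocus (RingHom.id B)) B] :
    ∃ v : Fin p → B, Submodule.span ((σ : B →+* B).eqLocus (RingHom.id B)) (Set.range v) = ⊤ := by
  classical
  haveI : Fact p.Prime := ⟨hp⟩
  set A : Subring B := (σ : B →+* B).eqLocus (RingHom.id B) with hA_def
  have memA : ∀ b : B, b ∈ A ↔ σ b = b := fun b => Iff.rfl
  -- the fraction field and the induced automorphism (as in `kl_free`)
  let L := FractionRing B
  let ι : B →+* L := algebraMap B L
  have hι : Function.Injective ι := IsFractionRing.injective B L
  let σL : L ≃+* L := IsFractionRing.ringEquivOfRingEquivHom B L σ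
  have hσLpow : ∀ (k : ℕ) (b : B), (σL ^ k) (ι b) = ι ((σ ^ k) b) := by
    intro k b
    have : σL ^ k = IsFractionRing.ringEquivOfRingEquivHom B L (σ ^ k) := (map_pow _ σ k).symm
    rw [this, IsFractionRing.ringEquivOfRingEquivHom_apply,
      IsFractionRing.ringEquivOfRingEquiv_algebraMap]
  have hσL : ∀ b, σL (ι b) = ι (σ b) := fun b => by simpa using hσLpow 1 b
  have hσLp : σL ^ p = 1 := by
    rw [show σL = IsFractionRing.ringEquivOfRingEquivHom B L σ from rfl, ← map_pow, hσ, map_one]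
  have hσL1 : σL ≠ 1 := by
    intro h
    apply hσ1
    ext b
    apply hι
    rw [← hσL, h]
    rfl
  -- the cyclic group generated by `σL` and its fixed field `K`
  let G : Subgroup (L ≃+* L) := Subgroup.zpowers σL
  have hfin : IsOfFinOrder σL := isOfFinOrder_iff_pow_eq_one.mpr ⟨p, hp.pos, hσLp⟩
  haveI : Fintype G := Fintype.ofEquiv _ (finEquivZPowers hfin)
  have hcard : Fintype.card G = p := by
    rw [Fintype.card_eq_nat_card, Nat.card_zpowers, orderOf_eq_prime hσLp hσL1]
  haveI : FaithfulSMul G L := ⟨fun {g₁ g₂} h => Subtype.ext (RingEquiv.ext h)⟩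
  let K : Subfield L := FixedPoints.subfield G L
  have memK : ∀ l : L, l ∈ K ↔ σL l = l := by
    intro l
    change (∀ g : G, g • l = l) ↔ _
    constructor
    · intro h
      exact h ⟨σL, Subgroup.mem_zpowers σL⟩
    · intro h g
      change (g : L ≃+* L) • l = l
      exact smul_eq_self_of_mem_zpowers g.2 h
  have hfinrank : Module.finrank K L = p := by rw [FixedPoints.finrank_eq_card, hcard]
  -- `σ`-invariant numerators and denominators for elements of `K`: the norm-like denominator
  -- `N b = ∏_{k<p} σ^k b` is invariant, non-zero for `b ≠ 0` and divisible by `b`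
  let N : B → B := fun b => ∏ k ∈ Finset.range p, (σ ^ k) b
  have hNfix : ∀ b, σ (N b) = N b := by
    intro b
    obtain ⟨m, hm⟩ : ∃ m, p = m + 1 := ⟨p - 1, (Nat.sub_add_cancel hp.pos).symm⟩
    simp only [N, map_prod]
    have e1 : ∀ k, σ ((σ ^ k) b) = (σ ^ (k + 1)) b := fun k => by rw [kl_pow_succ_apply]
    simp_rw [e1, hm]
    rw [Finset.prod_range_succ, Finset.prod_range_succ' (fun k => (σ ^ k) b), ← hm, hσ, pow_zero]
  have hN0 : ∀ b, b ≠ 0 → N b ≠ 0 := by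
    intro b hb
    simp only [N]
    rw [Finset.prod_ne_zero_iff]
    intro k _
    exact (map_ne_zero_iff _ (σ ^ k).injective).mpr hb
  have hNdvd : ∀ b, b ∣ N b := by
    intro b
    have h := Finset.dvd_prod_of_mem (fun k => (σ ^ k) b) (Finset.mem_range.mpr hp.pos)
    simp only [pow_zero, RingAut.one_apply] at h
    exact h
  have hK : ∀ k : K, ∃ c d : B, σ c = c ∧ σ d = d ∧ d ≠ 0 ∧ (k : L) * ι d = ι c := by
    intro k
    obtain ⟨b, b', hb', hk⟩ := IsFractionRing.div_surjective (A := B) (k : L)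
    have hb'0 : b' ≠ 0 := nonZeroDivisors.ne_zero hb'
    obtain ⟨m, hm⟩ := hNdvd b'
    have e1 : (k : L) * ι (N b') = ι (b * m) := by
      have : ι b' ≠ 0 := (map_ne_zero_iff ι hι).mpr hb'0
      rw [← hk, hm, map_mul, map_mul, ← mul_assoc, div_mul_cancel₀ _ this]
    refine ⟨b * m, N b', ?_, hNfix b', hN0 b' hb'0, e1⟩
    have hkK : σL (k : L) = k := (memK _).mp k.2
    have e2 : σL ((k : L) * ι (N b')) = (k : L) * ι (N b') := by
      rw [map_mul, hkK, hσL, hNfix]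
    rw [e1, hσL] at e2
    exact hι e2
  have hsmul : ∀ (k : K) (x : L), k • x = (k : L) * x := fun _ _ => rfl
  -- an `A`-basis of `B` is `K`-linearly independent in `L`
  let I := Module.Free.ChooseBasisIndex A B
  let bs : Module.Basis I A B := Module.Free.chooseBasis A B
  have hli : LinearIndependent K fun i : I => ι (bs i) := by
    rw [Fintype.linearIndependent_iff]
    intro g hg
    choose c d hc hd hd0 hcd using fun i => hK (g i)
    -- common invariant denominator
    let D : B := ∏ i, d i
    have hDfix : σ D = D := by simp only [D, map_prod]; exact Finset.prod_congr rfl fun i _ => hd i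
    have hgD : ∀ i, (g i : L) * ι D = ι (c i * ∏ j ∈ Finset.univ.erase i, d j) := by
      intro i
      simp only [D]
      rw [← Finset.mul_prod_erase Finset.univ d (Finset.mem_univ i), map_mul, ← mul_assoc, hcd i,
        map_mul]
    let a : I → A := fun i => ⟨c i * ∏ j ∈ Finset.univ.erase i, d j, by
      rw [memA, map_mul, hc i, map_prod]
      congr 1
      exact Finset.prod_congr rfl fun j _ => hd j⟩
    have hg' : ∑ i, (g i : L) * ι (bs i) = 0 := by simpa only [hsmul] using hg
    have hsum : ∑ i, a i • bs i = 0 := by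
      apply hι
      rw [map_sum, map_zero]
      calc ∑ i, ι (a i • bs i) = ∑ i, ((g i : L) * ι (bs i)) * ι D := by
            refine Finset.sum_congr rfl fun i _ => ?_
            have hai : ι (a i : B) = (g i : L) * ι D := (hgD i).symm
            rw [Subring.smul_def, smul_eq_mul, map_mul, hai]
            ring
        _ = (∑ i, (g i : L) * ι (bs i)) * ι D := by rw [Finset.sum_mul]
        _ = 0 := by rw [hg', zero_mul]
    intro i
    have hai : a i = 0 := Fintype.linearIndependent_iff.mp bs.linearIndependent a hsum i
    have hci : c i = 0 := by
      have h1 : (c i) * ∏ j ∈ Finset.univ.erase i, d j = 0 := congrArg Subtype.val hai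
      rcases mul_eq_zero.mp h1 with h | h
      · exact h
      · exact absurd h (Finset.prod_ne_zero_iff.mpr fun j _ => hd0 j)
    have : (g i : L) * ι (d i) = 0 := by rw [hcd i, hci, map_zero]
    rcases mul_eq_zero.mp this with h | h
    · exact Subtype.ext h
    · exact absurd h ((map_ne_zero_iff ι hι).mpr (hd0 i))
  have hcardI : Fintype.card I ≤ p := hfinrank ▸ hli.fintype_card_le_finrank
  -- reindex the basis into `Fin p`
  let e : I ↪ Fin p := (Fintype.equivFin I).toEmbedding.trans (Fin.castLEEmb hcardI)
  let v : Fin p → B := fun j => if h : ∃ i, e i = j then bs (Classical.choose h) else 0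
  have hv : ∀ i, v (e i) = bs i := by
    intro i
    have h : ∃ i', e i' = e i := ⟨i, rfl⟩
    simp only [v, dif_pos h]
    congr
    exact e.injective (Classical.choose_spec h)
  refine ⟨v, ?_⟩
  rw [eq_top_iff, ← bs.span_eq, Submodule.span_le]
  rintro _ ⟨i, rfl⟩
  rw [← hv i]
  exact Submodule.subset_span ⟨e i, rfl⟩

end Rank

section Two

/-- **The `p = 2` step** (Király–Lütkebohmert §3, «In the case `p = 2` …», uniformised): let `B` be
a local ring with a ring automorphism `σ`, and suppose `B` is generated as a module over the fixed
ring `B^σ` by two elements `v 0, v 1`. Then one of them, `β`, already gives `B = B^σ + B^σ·β`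
(from `1 = a₀ v₀ + a₁ v₁` one summand is a unit), so `B = B^σ[β]` is monogenous and the
augmentation ideal is `(σ β − β)`. [cite: KiralyLutkebohmert2013, §3 p. 70, Thm. 2 (b)⇒(a)] -/
theorem kl_exists_augIdeal_eq_span_singleton_of_span_two {B : Type*} [CommRing B] [IsLocalRing B]
    (σ : B ≃+* B) (v : Fin 2 → B)
    (hv : Submodule.span ((σ : B →+* B).eqLocus (RingHom.id B)) (Set.range v) = ⊤) :
    ∃ β : B, Ideal.span (Set.range fun c : B => σ c - c) = Ideal.span {σ β - β} := by
  classical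
  set A : Subring B := (σ : B →+* B).eqLocus (RingHom.id B) with hA_def
  have memA : ∀ b : B, b ∈ A ↔ σ b = b := fun b => Iff.rfl
  have hrep : ∀ b : B, ∃ c : Fin 2 → A, b = (c 0 : B) * v 0 + (c 1 : B) * v 1 := by
    intro b
    have hb : b ∈ Submodule.span A (Set.range v) := by rw [hv]; exact Submodule.mem_top
    rw [Submodule.mem_span_range_iff_exists_fun] at hb
    obtain ⟨c, hc⟩ := hb
    refine ⟨c, ?_⟩
    rw [← hc]
    simp only [Fin.sum_univ_two, Subring.smul_def, smul_eq_mul]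
  -- the symmetric core: if the coefficient of `v i` in `1` is a unit then `β = v j` works
  have core : ∀ (x z : B) (a₀ a₁ : B), σ a₀ = a₀ → σ a₁ = a₁ → a₀ * x + a₁ * z = 1 → IsUnit a₀ →
      (∀ b : B, ∃ e f : B, σ e = e ∧ σ f = f ∧ b = e * x + f * z) →
      Ideal.span (Set.range fun c : B => σ c - c) = Ideal.span {σ z - z} := by
    intro x z a₀ a₁ ha₀ ha₁ h1 hu hgen
    obtain ⟨w, hw⟩ := hu.exists_right_inv
    have hwfix : σ w = w := by
      have h2 : a₀ * σ w = 1 := by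
        have := congrArg σ hw
        rwa [map_mul, map_one, ha₀] at this
      calc σ w = σ w * (a₀ * w) := by rw [hw, mul_one]
        _ = (a₀ * σ w) * w := by ring
        _ = w := by rw [h2, one_mul]
    have hx : x = w * (1 - a₁ * z) := by
      have hw' : w * a₀ = 1 := by rw [mul_comm]; exact hw
      calc x = (w * a₀) * x := by rw [hw', one_mul]
        _ = w * (a₀ * x) := by ring
        _ = w * (1 - a₁ * z) := by rw [← h1]; ring
    apply le_antisymm
    · rw [Ideal.span_le]
      rintro _ ⟨b, rfl⟩
      obtain ⟨e, f, he, hf, hb⟩ := hgen b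
      have hb' : σ b - b = (f - e * w * a₁) * (σ z - z) := by
        rw [hb, hx]
        simp only [map_add, map_mul, map_sub, map_one, he, hf, hwfix, ha₁]
        ring
      show σ b - b ∈ Ideal.span {σ z - z}
      rw [hb']
      exact Ideal.mul_mem_left _ _ (Ideal.mem_span_singleton_self _)
    · rw [Ideal.span_le, Set.singleton_subset_iff]
      exact Ideal.subset_span ⟨z, rfl⟩
  obtain ⟨c, hc⟩ := hrep 1
  have hgen01 : ∀ b : B, ∃ e f : B, σ e = e ∧ σ f = f ∧ b = e * v 0 + f * v 1 := fun b => by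
    obtain ⟨c', hc'⟩ := hrep b
    exact ⟨c' 0, c' 1, (c' 0).2, (c' 1).2, hc'⟩
  rcases IsLocalRing.isUnit_or_isUnit_of_add_one hc.symm with h0 | h1
  · exact ⟨v 1, core (v 0) (v 1) (c 0) (c 1) (c 0).2 (c 1).2 hc.symm (isUnit_of_mul_isUnit_left h0)
      hgen01⟩
  · refine ⟨v 0, core (v 1) (v 0) (c 1) (c 0) (c 1).2 (c 0).2 (by rw [add_comm]; exact hc.symm)
      (isUnit_of_mul_isUnit_left h1) fun b => ?_⟩
    obtain ⟨e, f, he, hf, hb⟩ := hgen01 b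
    exact ⟨f, e, hf, he, by rw [hb]; ring⟩

/-- **Király–Lütkebohmert, Conjecture 9 in the case `p = 2`** (proved in print, §3 p. 70): let `B`
be a regular local ring with a ring automorphism `σ ≠ 1`, `σ² = 1`, such that `B` is module-finite
over the fixed ring `A = B^σ` (automatic in the geometric situation). If `A` is a regular local ring
then the augmentation ideal `I_G = (σ c − c : c ∈ B)` is principal. Proof as printed: `B` is free
over `A` (Serre IV Prop. 22 — here Bruns–Herzog 2.2.11), of rank `2`; then `B = A + Aβ` is
monogenous and `I_G = (σ β − β)`. [cite: KiralyLutkebohmert2013, §3 Conjecture 9 (case p = 2), p. 70] -/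
theorem kl_conjecture9_two {B : Type u} [CommRing B] [IsRegularLocalRing B]
    (σ : B ≃+* B) (hσ2 : σ ^ 2 = 1) (hσ1 : σ ≠ 1)
    [IsRegularLocalRing ((σ : B →+* B).eqLocus (RingHom.id B))]
    [Module.Finite ((σ : B →+* B).eqLocus (RingHom.id B)) B] :
    (Ideal.span (Set.range fun c : B => σ c - c)).IsPrincipal := by
  haveI : IsDomain B := Literature.AlgebraicGeometry.Resolution.isDomain_of_isRegularLocalRing B
  haveI : Module.Free ((σ : B →+* B).eqLocus (RingHom.id B)) B :=
    kl_free_of_isRegularLocalRing_fixed σ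
  obtain ⟨v, hv⟩ := kl_exists_fin_span_eq_top_of_free Nat.prime_two σ hσ2 hσ1
  obtain ⟨β, hβ⟩ := kl_exists_augIdeal_eq_span_singleton_of_span_two σ v hv
  exact ⟨⟨σ β - β, hβ⟩⟩


/-- **Conjecture 9 of Király–Lütkebohmert is TRUE for `p = 2`** (both directions, packaged): for a
regular local ring `B`, a ring automorphism `σ ≠ 1` with `σ² = 1` and `B` module-finite over the
fixed ring `B^σ`, the fixed ring is regular iff the augmentation ideal `(σ c − c : c ∈ B)` is
principal. `⇐` is Thm. 2 (a) ⇒ (d) (the tree's discharged named facts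
`KiralyLutkebohmert2013_thm2_first/second_holds` through
`KiralyLutkebohmert2013_thm2_regular_of_isPrincipal`); `⇒` is `kl_conjecture9_two`.
[cite: KiralyLutkebohmert2013, §3 Conjecture 9 (case p = 2), p. 70; Thm. 2] -/
theorem kl_isRegularLocalRing_fixed_iff_isPrincipal_two {B : Type u} [CommRing B]
    [IsRegularLocalRing B] (σ : B ≃+* B) (hσ2 : σ ^ 2 = 1) (hσ1 : σ ≠ 1)
    [Module.Finite ((σ : B →+* B).eqLocus (RingHom.id B)) B] :
    IsRegularLocalRing ((σ : B →+* B).eqLocus (RingHom.id B)) ↔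
      (Ideal.span (Set.range fun c : B => σ c - c)).IsPrincipal := by
  constructor
  · intro h
    exact kl_conjecture9_two σ hσ2 hσ1
  · intro h
    exact Literature.AlgebraicGeometry.Resolution.KiralyLutkebohmert2013_thm2_regular_of_isPrincipal
      Literature.AlgebraicGeometry.Resolution.KiralyLutkebohmert2013_thm2_first_holds
      Literature.AlgebraicGeometry.Resolution.KiralyLutkebohmert2013_thm2_second_holds 2
      Nat.prime_two B σ hσ1 hσ2 h

end Two

end Summit.ResolutionOfSingularities.ResolutionOfSingularities.Theorems
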